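import Literature.Computability.Complexity.CircuitClassesProofs
import HarnessLib

/-!
# Circuit complexity: the infimum is attained (proofs; trunk CplxCore)

Discharges (D-0014) two named facts about `circuitSizeOver B f = sInf {sizes of circuits over B
computing f}` (`Circuit.lean`) and `SIZE` (`CircuitClasses.lean`):

* `circuitSizeOver_mono_holds` — antitone in the basis when some circuit over the smaller basis
  computes `f` (the infimum over the smaller basis is attained, `Nat.sInf_mem`);
* `mem_SIZE_iff_circuitSize_le_holds` — `L ∈ SIZE s ↔ ∀ n, L.circuitSize n ≤ s n`: (`→`)
  `circuitSizeOver_le_of_computes`; (`←`) over `B₂` every slice `L ∩ {0,1}ⁿ` has a circuit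
  (`cktSize_univ`, Arora–Barak 2009, Claim 2.13, with `CktSize.toCircuit`), so the infimum
  defining `Language.circuitSize` is attained by a circuit of size `≤ s n`; choose one per length.

## References

* H. Vollmer, *Introduction to Circuit Complexity*, Springer 1999, Def. 1.7, §1.2.
* S. Arora, B. Barak, *Computational Complexity: A Modern Approach*, CUP 2009, Def. 6.1–6.2,
  Claim 2.13.
-/

namespace Literature.Computability.Complexity

/-- The set of sizes of circuits over `B` computing `f`; if it is nonempty its infimum is attained
(`Nat.sInf_mem`). [Vollmer 1999, Def. 1.7] [cite: Vollmer1999, Def. 1.7] -/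
theorem exists_circuit_size_eq_circuitSizeOver {ι : Type*} {B : Set GateFn} {f : (ι → Bool) → Bool}
    (h : ∃ C : Circuit ι, C.IsOver B ∧ C.Computes f) :
    ∃ C : Circuit ι, C.IsOver B ∧ C.Computes f ∧ C.size = circuitSizeOver B f := by
  obtain ⟨C, hB, hf⟩ := h
  have hne : {s | ∃ C : Circuit ι, C.IsOver B ∧ C.Computes f ∧ C.size = s}.Nonempty :=
    ⟨C.size, C, hB, hf, rfl⟩
  obtain ⟨C', hB', hf', hs⟩ := Nat.sInf_mem hne
  exact ⟨C', hB', hf', hs⟩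

/-- **Discharge of `circuitSizeOver_mono`** (`Circuit.lean`): a larger basis can only lower the
circuit complexity, provided some circuit over the smaller basis computes `f`. [cite: Vollmer1999, §1.2] -/
theorem circuitSizeOver_mono_holds : circuitSizeOver_mono := by
  intro ι B B' hBB' f h
  obtain ⟨C, hB, hf, hs⟩ := exists_circuit_size_eq_circuitSizeOver h
  rw [← hs]
  exact circuitSizeOver_le_of_computes C (fun g hg => hBB' (hB g hg)) hf

/-- Over `B₂` every slice function has a circuit, so `Language.circuitSize L n` is attained by a
`B₂`-circuit computing `L.sliceFn n`. [Arora–Barak 2009, Claim 2.13, Def. 6.1–6.2] [cite: AroraBarakCC2009, Claim 2.13] -/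
theorem exists_circuit_size_eq_circuitSize (L : Language Bool) (n : ℕ) :
    ∃ C : Circuit (Fin n), C.IsOver B2 ∧ C.Computes (L.sliceFn n) ∧ C.size = L.circuitSize n := by
  obtain ⟨C, hB, -, hC⟩ := (cktSize_univ fun (x : Fin n → Bool) (_ : Unit) => L.sliceFn n x).toCircuit
  exact exists_circuit_size_eq_circuitSizeOver ⟨C, hB, hC⟩

/-- **Discharge of `mem_SIZE_iff_circuitSize_le`** (`CircuitClasses.lean`): a language is in
`SIZE s` iff its circuit complexity at every length `n` is at most `s n` (Arora–Barak 2009,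
Def. 6.2). [cite: AroraBarakCC2009, Def. 6.2] -/
theorem mem_SIZE_iff_circuitSize_le_holds : mem_SIZE_iff_circuitSize_le := by
  intro L s
  constructor
  · rintro ⟨C, hC, hdec⟩ n
    refine (circuitSizeOver_le_of_computes (C n) (hC n).1 fun x => ?_).trans (hC n).2
    exact hdec.eval_eq x
  · intro h
    choose C hC using exists_circuit_size_eq_circuitSize L
    refine ⟨C, fun n => ⟨(hC n).1, ((hC n).2.2 ▸ h n : (C n).size ≤ s n)⟩, fun x => ?_⟩
    have := (hC x.length).2.1 x.get
    simpa [Language.sliceFn] using this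

end Literature.Computability.Complexity
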